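import Summits.Ventures.PercRepro.Night2T3ProfileA

/-!
# PercRepro — the CYCLIC-RANK PROFILE of a rank level set, part B: the stay caps (P3), partitions, the identity
(night-2 gen 3, NIGHT-2-profile.md §2–§3 — the objects of the profile LP; split from the original
`Night2T3Profile.lean` at the 400-line cap by night-2 gen 4, statements and proofs byte-identical; part A =
`Night2T3ProfileA.lean` carries `Pc`, `mv`, (P1), (P2))

* **(P3)** `mv_self_le`: `m(G) < m → mv k m m ≤ k·#Pc (k+1) m` (a set with a coloop that is not a coloop of `G` has at most
  `|G ∖ S| − 1` stay moves — Lemma D / absorption); `mv_self_eq`: `mv k m(G) m(G) = (k+1)·#Pc (k+1) m(G)` (all moves of the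
  top class are stays);
* the partition lemmas `card_level_eq_sum_card_Pc`, `sum_Rq_eq_sum_Pc`, and `card_Pc_zero`;
* simplicity: `card_Pc_eq_zero_of_nonbasis`, `card_Pc_eq_zero_of_basis`; `sum_card_Pc_le_DFq`;
* `Jq_three_mul_succ_eq_profile`: `(q+1)·J₃ = (q+2)·DF₃ + Σ_k Σ_m #Pc k m·((q² − 1)/(1 + m) − (q + 2))`.

Imports `Night2T3ProfileA` only.
-/
namespace PercRepro.Star

open Finset ThmH SixFour GenQ

variable {α : Type*} [DecidableEq α] {M : Matroid α} [M.Finite]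

/-! ## The stay caps (P3) -/

/-- **(P3)**: for `m(G) < m`, `mv k m m ≤ k·#Pc (k+1) m` (absorption: some `x` lowers the coloop count). -/
theorem mv_self_le {G : Finset α} {q : ℕ} (hG : G ⊆ gr M) (hrG : M.eRk (G : Set α) = (q : ℕ∞))
    (k : ℕ) {m : ℕ} (hm : mTr M G < m) : mv M G q k m m ≤ k * (Pc M G q (k + 1) m).card := by
  unfold mv
  rw [Finset.card_eq_sum_ones, Finset.mul_sum]
  apply Finset.sum_le_sum
  intro S hS
  have hS' := mem_Pc.1 hS
  -- a coloop of `S` outside the coloops of `G`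
  have hcard : (coloopsOf M G).card < (coloopsOf M S).card := by
    have h := hm
    rw [← hS'.2.2] at h
    exact h
  obtain ⟨c, hcS, hcG⟩ : ∃ c ∈ coloopsOf M S, c ∉ coloopsOf M G := by
    by_contra hall
    have hall' : coloopsOf M S ⊆ coloopsOf M G := fun c hc => by_contra (fun h => hall ⟨c, hc, h⟩)
    exact absurd (Finset.card_le_card hall') (not_le.2 hcard)
  obtain ⟨x, hxG, hxS, hx⟩ := exists_notMem_coloopsOf_insert hG hrG hS'.1 hcS hcG
  -- the stay filter misses `x`, so it has at most `|G ∖ S| − 1 = k` elements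
  have hmem : x ∈ G \ S := Finset.mem_sdiff.2 ⟨hxG, hxS⟩
  have hnot : x ∉ (G \ S).filter (fun x => mTr M (insert x S) = m) := by
    rw [Finset.mem_filter]
    rintro ⟨-, hmx⟩
    -- `c` is a coloop of `S` but not of `S ∪ x`, and `coloopsOf (S ∪ x) ⊆ coloopsOf S`: strict
    have hr := (mem_Rq.1 (insert_mem_Rq hrG hS'.1 hxG)).2
    have hxcl : x ∈ M.closure (S : Set α) := by
      apply mem_closure_of_eRk_insert_le' (hG hxG)
      rw [hr, (mem_Rq.1 hS'.1).2]
    have hsub := coloopsOf_insert_subset (M := M) hxS hxcl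
    have hss : coloopsOf M (insert x S) ⊂ coloopsOf M S := (Finset.ssubset_iff_of_subset hsub).2 ⟨c, hcS, hx⟩
    have h2 : mTr M (insert x S) < mTr M S := Finset.card_lt_card hss
    rw [hmx, hS'.2.2] at h2
    exact lt_irrefl _ h2
  have h1 : ((G \ S).filter (fun x => mTr M (insert x S) = m)).card < (G \ S).card :=
    Finset.card_lt_card ((Finset.ssubset_iff_of_subset (Finset.filter_subset _ _)).2 ⟨x, hmem, hnot⟩)
  rw [hS'.2.1, mul_one] at *
  omega

/-- The top class is all stays: `mv k m(G) m(G) = (k+1)·#Pc (k+1) m(G)`. -/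
theorem mv_self_eq {G : Finset α} {q : ℕ} (hG : G ⊆ gr M) (hrG : M.eRk (G : Set α) = (q : ℕ∞)) (k : ℕ) :
    mv M G q k (mTr M G) (mTr M G) = (k + 1) * (Pc M G q (k + 1) (mTr M G)).card := by
  unfold mv
  rw [Finset.card_eq_sum_ones, Finset.mul_sum]
  apply Finset.sum_congr rfl
  intro S hS
  have hS' := mem_Pc.1 hS
  have hfull : (G \ S).filter (fun x => mTr M (insert x S) = mTr M G) = G \ S := by
    apply Finset.filter_true_of_mem
    intro x hx
    have hx' := Finset.mem_sdiff.1 hx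
    apply le_antisymm
    · rw [← hS'.2.2]
      exact mTr_insert_le_of_mem_Rq hG hrG hS'.1 hx'.1 hx'.2
    · exact mTr_le_of_mem_Rq hG hrG (insert_mem_Rq hrG hS'.1 hx'.1)
  rw [hfull, hS'.2.1, mul_one]

/-! ## Partitions -/

/-- A level is the disjoint union of its classes: `#C_k = Σ_{m ∈ [m(G), q]} #Pc k m`. -/
theorem card_level_eq_sum_card_Pc {G : Finset α} {q : ℕ} (hG : G ⊆ gr M)
    (hrG : M.eRk (G : Set α) = (q : ℕ∞)) (k : ℕ) :
    ((Rq M G q).filter (fun S : Finset α => (G \ S).card = k)).card =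
      ∑ m ∈ Finset.Icc (mTr M G) q, (Pc M G q k m).card := by
  rw [Finset.card_eq_sum_card_fiberwise (s := (Rq M G q).filter (fun S : Finset α => (G \ S).card = k))
    (t := Finset.Icc (mTr M G) q) (f := fun S => mTr M S) (fun S hS => by
      have hS' := Finset.mem_filter.1 hS
      have hR := mem_Rq.1 hS'.1
      exact Finset.mem_coe.2 (Finset.mem_Icc.2
        ⟨mTr_le_of_mem_Rq hG hrG hS'.1, mTr_le_of_eRk_eq (hR.1.trans hG) hR.2⟩))]
  apply Finset.sum_congr rfl
  intro m _
  unfold Pc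
  rw [Finset.filter_filter]

/-- A sum over `R_q(G)` of a function of the level and the coloop count, by classes. -/
theorem sum_Rq_eq_sum_Pc {G : Finset α} {q d : ℕ} (hG : G ⊆ gr M)
    (hrG : M.eRk (G : Set α) = (q : ℕ∞)) (hcard : G.card = q + d) (f : ℕ → ℕ → ℚ) :
    ∑ S ∈ Rq M G q, f (G \ S).card (mTr M S) =
      ∑ k ∈ Finset.range (d + 1), ∑ m ∈ Finset.Icc (mTr M G) q, ((Pc M G q k m).card : ℚ) * f k m := by
  have hjd : ∀ S ∈ Rq M G q, (G \ S).card ≤ d := by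
    intro S hS
    have hS' := mem_Rq.1 hS
    have hSq : q ≤ S.card := le_card_of_eRk_eq hS'.2
    rw [Finset.card_sdiff_of_subset hS'.1]
    omega
  rw [← Finset.sum_fiberwise_of_maps_to (s := Rq M G q) (t := Finset.range (d + 1))
    (g := fun S : Finset α => (G \ S).card) (fun S hS => Finset.mem_range.2 (by have := hjd S hS; omega))]
  apply Finset.sum_congr rfl
  intro k _
  rw [← Finset.sum_fiberwise_of_maps_to (s := (Rq M G q).filter (fun S : Finset α => (G \ S).card = k))
    (t := Finset.Icc (mTr M G) q) (g := fun S => mTr M S) (fun S hS => by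
      have hS' := Finset.mem_filter.1 hS
      have hR := mem_Rq.1 hS'.1
      exact Finset.mem_coe.2 (Finset.mem_Icc.2
        ⟨mTr_le_of_mem_Rq hG hrG hS'.1, mTr_le_of_eRk_eq (hR.1.trans hG) hR.2⟩))]
  apply Finset.sum_congr rfl
  intro m _
  rw [Finset.sum_congr rfl (fun S hS => by
    have hS' := Finset.mem_filter.1 hS
    have hS'' := Finset.mem_filter.1 hS'.1
    rw [hS'.2, hS''.2]), Finset.sum_const, nsmul_eq_mul]
  unfold Pc
  rw [Finset.filter_filter]

/-- Level `0` is `{G}`: `#Pc 0 m(G) = 1` and `#Pc 0 m = 0` for `m ≠ m(G)`. -/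
theorem card_Pc_zero {G : Finset α} {q : ℕ} (hrG : M.eRk (G : Set α) = (q : ℕ∞)) (m : ℕ) :
    (Pc M G q 0 m).card = if m = mTr M G then 1 else 0 := by
  have hmem : ∀ S, S ∈ Pc M G q 0 m ↔ S = G ∧ m = mTr M G := by
    intro S
    rw [mem_Pc, mem_Rq, Finset.card_eq_zero, Finset.sdiff_eq_empty_iff_subset]
    constructor
    · rintro ⟨⟨hSG, -⟩, hGS, hm⟩
      have : S = G := Finset.Subset.antisymm hSG hGS
      exact ⟨this, by rw [← hm, this]⟩
    · rintro ⟨rfl, rfl⟩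
      exact ⟨⟨Finset.Subset.refl _, hrG⟩, Finset.Subset.refl _, rfl⟩
  split_ifs with h
  · rw [Finset.card_eq_one]
    exact ⟨G, Finset.ext (fun S => by rw [hmem, Finset.mem_singleton]; exact ⟨fun h' => h'.1, fun h' => ⟨h', h⟩⟩)⟩
  · rw [Finset.card_eq_zero, Finset.eq_empty_iff_forall_notMem]
    intro S hS
    exact h (hmem S |>.1 hS).2

/-! ## Simplicity: the possible coloop counts -/

/-- Below the top level a class with `m ≥ q − 1` is empty on a simple matroid (a spanning non-basis has `≤ q − 2` coloops). -/
theorem card_Pc_eq_zero_of_nonbasis (hs : Simple M) {G : Finset α} {q d : ℕ} (hG : G ⊆ gr M)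
    (hq : 1 ≤ q) (hcard : G.card = q + d) {k m : ℕ} (hk : k < d)
    (hm : q ≤ m + 1) : (Pc M G q k m).card = 0 := by
  rw [Finset.card_eq_zero, Finset.eq_empty_iff_forall_notMem]
  intro S hS
  have hS' := mem_Pc.1 hS
  have hR := mem_Rq.1 hS'.1
  have hsd := Finset.card_sdiff_of_subset hR.1
  have hle := Finset.card_le_card hR.1
  rw [hS'.2.1] at hsd
  have hlt : q < S.card := by omega
  have := mTr_add_two_le_of_spanning_nonbasis hs (hR.1.trans hG) hR.2 hq hlt
  omega

/-- At the top level the only class is `m = q` (the bases). -/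
theorem card_Pc_eq_zero_of_basis {G : Finset α} {q d : ℕ} (hcard : G.card = q + d) {m : ℕ} (hm : m ≠ q) :
    (Pc M G q d m).card = 0 := by
  rw [Finset.card_eq_zero, Finset.eq_empty_iff_forall_notMem]
  intro S hS
  have hS' := mem_Pc.1 hS
  have hR := mem_Rq.1 hS'.1
  have hsd := Finset.card_sdiff_of_subset hR.1
  have hle := Finset.card_le_card hR.1
  rw [hS'.2.1] at hsd
  have hcardS : S.card = q := by omega
  have hB : S ∈ Bq M G q := mem_Bq.2 ⟨hR.1, hR.2, hcardS⟩
  exact hm (hS'.2.2 ▸ mTr_eq_of_mem_Bq hB)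

/-- The first three levels are demand-free: `Σ_{k ≤ 2} Σ_m #Pc k m ≤ DF_3`. -/
theorem sum_card_Pc_le_DFq {G : Finset α} {q : ℕ} (hG : G ⊆ gr M) (hrG : M.eRk (G : Set α) = (q : ℕ∞)) :
    (∑ m ∈ Finset.Icc (mTr M G) q, (Pc M G q 0 m).card) + (∑ m ∈ Finset.Icc (mTr M G) q, (Pc M G q 1 m).card) +
      (∑ m ∈ Finset.Icc (mTr M G) q, (Pc M G q 2 m).card) ≤ DFq M G q 3 := by
  rw [← card_level_eq_sum_card_Pc hG hrG 0, ← card_level_eq_sum_card_Pc hG hrG 1,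
    ← card_level_eq_sum_card_Pc hG hrG 2]
  exact (card_three_le_card_filter_le_two (M := M) G q).trans (card_filter_sdiff_le_two_le_DFq (M := M) (G := G) (q := q))

/-- The balance in the profile: `(q+1)·J_3 = (q+2)·DF_3 + Σ_{k ≤ d} Σ_{m} #Pc k m · ((q²−1)/(1+m) − (q+2))`. -/
theorem Jq_three_mul_succ_eq_profile {G : Finset α} {q d : ℕ} (hG : G ⊆ gr M)
    (hrG : M.eRk (G : Set α) = (q : ℕ∞)) (hcard : G.card = q + d) :
    ((q : ℚ) + 1) * Jq M G q 3 = ((q : ℚ) + 2) * (DFq M G q 3 : ℚ) +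
      ∑ k ∈ Finset.range (d + 1), ∑ m ∈ Finset.Icc (mTr M G) q,
        ((Pc M G q k m).card : ℚ) * (((q : ℚ) ^ 2 - 1) / (1 + (m : ℚ)) - ((q : ℚ) + 2)) := by
  rw [Jq_three_mul_succ_eq]
  congr 1
  have h := sum_Rq_eq_sum_Pc hG hrG hcard (fun _ m => ((q : ℚ) ^ 2 - 1) / (1 + (m : ℚ)) - ((q : ℚ) + 2))
  rw [← h]
  apply Finset.sum_congr rfl
  intro S _
  unfold wInf
  ring

end PercRepro.Star
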